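import Summits.AnomalousDissipation.AnomalousDissipation.Theses.TwoAndHalfD
import Literature.Analysis.FluidPDE.ZerothLaw
import Literature.Analysis.FluidPDE.LongTimeAverageNonneg
import Literature.Barriers.AnomalousDissipation.ShellDefectEnstrophyBound
import Literature.Barriers.AnomalousDissipation.TwoDimensionalEnergyDissipation
import HarnessLib

/-!
# Strategist census s3 — typed companion (crux `TwoAndHalfD.ScalarAnomalySteadySourceFormal`,
# stmt-AnomalousDissipation-0448)

Companion of `STRATEGY-CENSUS.md` (crux-strategist seat `cstrat-stmt-AnomalousDissipation-0448-s3`,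
2026-08-17, running alongside lead c2 of line `budgeted-mixer-template`, reshape r2, ONE open stub
S1'' `stub_meanSquareMixerRealizable`).  NOTHING here is a line or a stub of the crux; no `sorry`.
It extends (does not repeat) the s1/s2 companions `STRATEGY_CENSUS.lean` / `STRATEGY_CENSUS_S2.lean`.

What is typed here (all over existing declarations):

* `IsWitness` — the clause set of `#2 := ScalarAnomalySteadySourceFormal` for GIVEN data, with
  `crux_iff_exists_isWitness` (definitional repackaging) and `IsWitness.comp_strictMono`
  (a subsequence of a witness family is a witness family).
* STRENGTHEN (§Strengthen of the census, the ENSTROPHY-FLUX DICHOTOMY).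
  `CascadingWitness` (S⁺_casc: a witness whose planar flows keep a residual mean ENSTROPHY dissipation
  `η_j = ⟨ν_j‖Δv_j‖²⟩ ≥ η₀ > 0`, `Literature.Analysis.FluidPDE.meanEnstrophyDissipation`) and
  `SelectiveWitness` (S⁺_sel: a witness with `η_j → 0`, i.e. the scalar dissipates at rate `≥ ε` while the
  vorticity — its Prandtl-one twin with source `curl g` — does not).  Proved: each implies `#2`
  (`cascadingWitness_imp`, `selectiveWitness_imp`) and the dichotomy is EXHAUSTIVE,
  `crux_iff_cascading_or_selective : #2 ↔ S⁺_casc ∨ S⁺_sel` (subsequence selection, `seq_dichotomy`).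
  The census explains why neither branch acquires a tool: S⁺_casc lives in the force-DRAINED condensate
  regime (by `Literature.Barriers.AnomalousDissipation.shellDefect_meanEnstrophy_le` a band-limited witness
  with unbounded mean enstrophy must do negative mean work `≫ ν_j` against its lower forced shells, and
  for two shells `η_j - (λ_b-λ_a)·drain_j → 0`), where KLB phenomenology makes the variance clause fail
  by a fractional power of `log(1/ν)`; S⁺_sel is the `h`-versus-`curl g` SELECTIVITY regime of the
  registered line `isotypic-source-selection`.
* DECOMPOSITION (§Decomposition, split D7).  `EnstrophyAnomalySteady2D` — the pure Navier–Stokes half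
  of S⁺_casc: a bounded-mean-energy, steadily forced 2-D family with a residual enstrophy dissipation
  floor (the negation of Alexakis–Doering's condition (con) with an `O(1)` residue: Phys. Lett. A 359
  (2006) §4–5, "whether (con) might hold for more general forcing functions is an open question";
  energy dissipation, by contrast, always vanishes like `ν^{1/2}`:
  `Literature.Barriers.AnomalousDissipation.AlexakisDoering2006_energyDissipationBound`).  Proved:
  `enstrophyAnomaly_of_cascadingWitness : S⁺_casc → EnstrophyAnomalySteady2D`.  The census records why this
  piece, although a named open problem, does NOT feed `#2` (with `h = curl g` the variance IS the enstrophy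
  and diverges; with `h ≠ curl g` there is no implication either way), so D7 is not a decomposition of the
  crux.
-/

open Filter Topology MeasureTheory
open Literature.Analysis.FunctionSpaces Literature.Analysis.FluidPDE

noncomputable section

namespace Summit.AnomalousDissipation.AnomalousDissipation.Cruxes.ScalarAnomalySteadySourceFormal.Census3

local notation "𝕋²" => UnitAddTorus (Fin 2)
local notation "E²" => EuclideanSpace ℝ (Fin 2)

/-- The clause set of the crux `#2` for a GIVEN steady force `g`, steady source `h`, viscosity sequence
`ν`, Leray–Hopf data/solutions `(v₀, v)` and weak sourced scalars `(θ₀, θ)` — verbatim the body of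
`Theses.TwoAndHalfD.ScalarAnomalySteadySourceFormal` after its existential quantifiers. -/
def IsWitness (g : 𝕋² → E²) (h : 𝕋² → ℝ) (ν : ℕ → ℝ) (v₀ : ℕ → 𝕋² → E²)
    (v : ℕ → ℝ → 𝕋² → E²) (θ₀ : ℕ → 𝕋² → ℝ) (θ : ℕ → ℝ → 𝕋² → ℝ) : Prop :=
  Torus.IsSmooth g ∧ Torus.IsDivFree g ∧ Torus.HasZeroMean g ∧ Torus.IsSmooth h ∧
  Torus.HasZeroMean h ∧ (∀ j, 0 < ν j) ∧ Tendsto ν atTop (𝓝 0) ∧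
  (∀ j, Torus.IsGlobalLerayHopf (ν j) (fun _ => g) (v₀ j) (v j)) ∧
  (∀ j, MemLp (θ₀ j) 2 volume) ∧
  (∀ j, Torus.IsWeakScalarTransportForced (ν j) (v j) (fun _ => h) (θ₀ j) (θ j)) ∧
  (∃ E : ℝ, ∀ j, meanEnergy (v j) ≤ E) ∧
  (∃ E : ℝ, ∀ j, longTimeAvgSup (fun t => Torus.scalarL2Sq (θ j t)) ≤ E) ∧
  ∃ ε : ℝ, 0 < ε ∧ ∀ j, ε ≤ longTimeAvgSup (fun t => ν j * (Torus.eScalarGradNormSq (θ j t)).toReal)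

/-- `#2` is, definitionally, the existence of a witness in the sense of `IsWitness`. -/
theorem crux_iff_exists_isWitness :
    Theses.TwoAndHalfD.ScalarAnomalySteadySourceFormal ↔
      ∃ g h ν v₀ v θ₀ θ, IsWitness g h ν v₀ v θ₀ θ := by
  constructor
  · rintro ⟨g, h, hg, hgd, hgm, hh, hhm, ν, v₀, v, θ₀, θ, hν, hν0, hLH, hθ₀, hθ, hE, hV, hε⟩
    exact ⟨g, h, ν, v₀, v, θ₀, θ, hg, hgd, hgm, hh, hhm, hν, hν0, hLH, hθ₀, hθ, hE, hV, hε⟩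
  · rintro ⟨g, h, ν, v₀, v, θ₀, θ, hg, hgd, hgm, hh, hhm, hν, hν0, hLH, hθ₀, hθ, hE, hV, hε⟩
    exact ⟨g, h, hg, hgd, hgm, hh, hhm, ν, v₀, v, θ₀, θ, hν, hν0, hLH, hθ₀, hθ, hE, hV, hε⟩

/-- A subsequence of a witness family is a witness family (every clause is `∀ j`, a `j`-uniform
constant, or `ν_j → 0`). -/
theorem IsWitness.comp_strictMono {g : 𝕋² → E²} {h : 𝕋² → ℝ} {ν : ℕ → ℝ} {v₀ : ℕ → 𝕋² → E²}
    {v : ℕ → ℝ → 𝕋² → E²} {θ₀ : ℕ → 𝕋² → ℝ} {θ : ℕ → ℝ → 𝕋² → ℝ}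
    (hw : IsWitness g h ν v₀ v θ₀ θ) {φ : ℕ → ℕ} (hφ : StrictMono φ) :
    IsWitness g h (ν ∘ φ) (v₀ ∘ φ) (v ∘ φ) (θ₀ ∘ φ) (θ ∘ φ) := by
  obtain ⟨hg, hgd, hgm, hh, hhm, hν, hν0, hLH, hθ₀, hθ, ⟨E, hE⟩, ⟨B, hB⟩, ⟨ε, hε, hεj⟩⟩ := hw
  exact ⟨hg, hgd, hgm, hh, hhm, fun j => hν (φ j), hν0.comp hφ.tendsto_atTop, fun j => hLH (φ j),
    fun j => hθ₀ (φ j), fun j => hθ (φ j), ⟨E, fun j => hE (φ j)⟩, ⟨B, fun j => hB (φ j)⟩,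
    ⟨ε, hε, fun j => hεj (φ j)⟩⟩

/-- The mean ENSTROPHY dissipation sequence `η_j = ⟨ν_j ‖Δ v_j‖₂²⟩` of a family (Alexakis–Doering's
`χ`; `Literature.Analysis.FluidPDE.meanEnstrophyDissipation`, limsup of running means, spectral
`‖Δ·‖²`, `toReal` junk as recorded there). -/
def enstrophyDiss (ν : ℕ → ℝ) (v : ℕ → ℝ → 𝕋² → E²) (j : ℕ) : ℝ :=
  meanEnstrophyDissipation (ν j) (v j)

theorem enstrophyDiss_nonneg {ν : ℕ → ℝ} (hν : ∀ j, 0 < ν j) (v : ℕ → ℝ → 𝕋² → E²) (j : ℕ) :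
    0 ≤ enstrophyDiss ν v j :=
  longTimeAvgSup_nonneg fun _ => mul_nonneg (hν j).le ENNReal.toReal_nonneg

@[simp] theorem enstrophyDiss_comp (ν : ℕ → ℝ) (v : ℕ → ℝ → 𝕋² → E²) (φ : ℕ → ℕ) :
    enstrophyDiss (ν ∘ φ) (v ∘ φ) = enstrophyDiss ν v ∘ φ := rfl

/-- **S⁺_casc (strengthening, "cascading" branch).** A witness of `#2` whose planar flows keep a
residual mean enstrophy dissipation `η_j ≥ η₀ > 0` along the whole family (an `O(1)` forward
enstrophy flux at bounded energy; for band-limited `g` this forces an `O(1)` negative mean work of the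
flow against the lower forced shells — the force-DRAINED condensate regime). -/
def CascadingWitness : Prop :=
  ∃ (g : 𝕋² → E²) (h : 𝕋² → ℝ) (ν : ℕ → ℝ) (v₀ : ℕ → 𝕋² → E²) (v : ℕ → ℝ → 𝕋² → E²)
    (θ₀ : ℕ → 𝕋² → ℝ) (θ : ℕ → ℝ → 𝕋² → ℝ),
    IsWitness g h ν v₀ v θ₀ θ ∧ ∃ η₀ : ℝ, 0 < η₀ ∧ ∀ j, η₀ ≤ enstrophyDiss ν v j

/-- **S⁺_sel (strengthening, "selective" branch).** A witness of `#2` whose planar flows have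
VANISHING residual enstrophy dissipation, `η_j → 0`: the scalar sourced by `h` dissipates at rate `≥ ε`
while its Prandtl-one twin, the vorticity sourced by `curl g`, does not — the flow mixes `h`'s pattern
but not `curl g`'s (source selectivity). -/
def SelectiveWitness : Prop :=
  ∃ (g : 𝕋² → E²) (h : 𝕋² → ℝ) (ν : ℕ → ℝ) (v₀ : ℕ → 𝕋² → E²) (v : ℕ → ℝ → 𝕋² → E²)
    (θ₀ : ℕ → 𝕋² → ℝ) (θ : ℕ → ℝ → 𝕋² → ℝ),
    IsWitness g h ν v₀ v θ₀ θ ∧ Tendsto (enstrophyDiss ν v) atTop (𝓝 0)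

/-- S⁺_casc ⇒ `#2` (forget the floor). -/
theorem cascadingWitness_imp :
    CascadingWitness → Theses.TwoAndHalfD.ScalarAnomalySteadySourceFormal := by
  rintro ⟨g, h, ν, v₀, v, θ₀, θ, hw, -⟩
  exact crux_iff_exists_isWitness.2 ⟨g, h, ν, v₀, v, θ₀, θ, hw⟩

/-- S⁺_sel ⇒ `#2` (forget the vanishing). -/
theorem selectiveWitness_imp :
    SelectiveWitness → Theses.TwoAndHalfD.ScalarAnomalySteadySourceFormal := by
  rintro ⟨g, h, ν, v₀, v, θ₀, θ, hw, -⟩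
  exact crux_iff_exists_isWitness.2 ⟨g, h, ν, v₀, v, θ₀, θ, hw⟩

/-- Real-variable dichotomy: a nonnegative sequence either has a subsequence tending to `0` or is
eventually bounded below by a positive constant. -/
theorem seq_dichotomy (d : ℕ → ℝ) (hd : ∀ j, 0 ≤ d j) :
    (∃ φ : ℕ → ℕ, StrictMono φ ∧ Tendsto (d ∘ φ) atTop (𝓝 0)) ∨
      ∃ η₀ : ℝ, 0 < η₀ ∧ ∃ J : ℕ, ∀ j, J ≤ j → η₀ ≤ d j := by
  by_cases H : ∃ η₀ : ℝ, 0 < η₀ ∧ ∃ J : ℕ, ∀ j, J ≤ j → η₀ ≤ d j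
  · exact Or.inr H
  · left
    push Not at H
    have hfreq : ∀ n : ℕ, ∃ᶠ k in atTop, d k < 1 / ((n : ℝ) + 1) := by
      intro n
      rw [frequently_atTop]
      intro J
      obtain ⟨j, hJj, hj⟩ := H (1 / ((n : ℝ) + 1)) (by positivity) J
      exact ⟨j, hJj, hj⟩
    obtain ⟨φ, hφ, hφd⟩ := extraction_forall_of_frequently hfreq
    refine ⟨φ, hφ, ?_⟩
    refine squeeze_zero (fun n => hd (φ n)) (fun n => (hφd n).le) ?_
    exact tendsto_one_div_add_atTop_nhds_zero_nat

/-- **The enstrophy-flux dichotomy is exhaustive**: every witness of `#2` yields, after passing to a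
subsequence (S⁺_sel) or discarding finitely many indices (S⁺_casc), a witness of one of the two
strengthenings. -/
theorem cascading_or_selective_of_crux
    (hc : Theses.TwoAndHalfD.ScalarAnomalySteadySourceFormal) :
    CascadingWitness ∨ SelectiveWitness := by
  obtain ⟨g, h, ν, v₀, v, θ₀, θ, hw⟩ := crux_iff_exists_isWitness.1 hc
  have hν : ∀ j, 0 < ν j := hw.2.2.2.2.2.1
  rcases seq_dichotomy (enstrophyDiss ν v) (enstrophyDiss_nonneg hν v) with ⟨φ, hφ, h0⟩ | ⟨η₀, hη₀, J, hJ⟩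
  · right
    exact ⟨g, h, ν ∘ φ, v₀ ∘ φ, v ∘ φ, θ₀ ∘ φ, θ ∘ φ, hw.comp_strictMono hφ, by simpa using h0⟩
  · left
    have hφ : StrictMono (fun j : ℕ => j + J) := fun a b hab => Nat.add_lt_add_right hab J
    refine ⟨g, h, ν ∘ (fun j => j + J), v₀ ∘ (fun j => j + J), v ∘ (fun j => j + J),
      θ₀ ∘ (fun j => j + J), θ ∘ (fun j => j + J), hw.comp_strictMono hφ, η₀, hη₀, fun j => ?_⟩
    exact hJ (j + J) (Nat.le_add_left J j)

/-- `#2 ↔ S⁺_casc ∨ S⁺_sel`. -/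
theorem crux_iff_cascading_or_selective :
    Theses.TwoAndHalfD.ScalarAnomalySteadySourceFormal ↔ CascadingWitness ∨ SelectiveWitness :=
  ⟨cascading_or_selective_of_crux, fun h => h.elim cascadingWitness_imp selectiveWitness_imp⟩

/-- **D7, pure Navier–Stokes piece: the 2-D ENSTROPHY dissipation anomaly under a steady force at bounded
mean energy.**  There exist a smooth divergence-free mean-zero steady force `g` on `𝕋²` and a family of
global Leray–Hopf solutions `v_j` at viscosities `ν_j → 0` with `j`-uniformly bounded mean energy whose
mean enstrophy dissipation `⟨ν_j‖Δv_j‖²⟩` stays `≥ η₀ > 0`.  Open in print: by Alexakis–Doering 2006 §4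
(positive injection at every forced wavenumber ⇒ `ε, χ ≲ Re⁻¹`) any such family with band-limited `g`
must do `O(1)` negative mean work against a lower forced shell
(`Literature.Barriers.AnomalousDissipation.shellDefect_meanEnstrophy_le`), and "whether (con) might hold
for more general forcing functions is an open question" (op. cit. §5); the ENERGY analogue is refuted
(`Literature.Barriers.AnomalousDissipation.AlexakisDoering2006_energyDissipationBound`). -/
def EnstrophyAnomalySteady2D : Prop :=
  ∃ g : 𝕋² → E², Torus.IsSmooth g ∧ Torus.IsDivFree g ∧ Torus.HasZeroMean g ∧
    ∃ (ν : ℕ → ℝ) (v₀ : ℕ → 𝕋² → E²) (v : ℕ → ℝ → 𝕋² → E²), (∀ j, 0 < ν j) ∧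
      Tendsto ν atTop (𝓝 0) ∧ (∀ j, Torus.IsGlobalLerayHopf (ν j) (fun _ => g) (v₀ j) (v j)) ∧
      (∃ E : ℝ, ∀ j, meanEnergy (v j) ≤ E) ∧
      ∃ η₀ : ℝ, 0 < η₀ ∧ ∀ j, η₀ ≤ meanEnstrophyDissipation (ν j) (v j)

/-- S⁺_casc projects onto the pure-NS open problem `EnstrophyAnomalySteady2D` (forget the scalar). -/
theorem enstrophyAnomaly_of_cascadingWitness : CascadingWitness → EnstrophyAnomalySteady2D := by
  rintro ⟨g, h, ν, v₀, v, θ₀, θ, ⟨hg, hgd, hgm, -, -, hν, hν0, hLH, -, -, hE, -, -⟩, η₀, hη₀, hη⟩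
  exact ⟨g, hg, hgd, hgm, ν, v₀, v, hν, hν0, hLH, hE, η₀, hη₀, hη⟩

end Summit.AnomalousDissipation.AnomalousDissipation.Cruxes.ScalarAnomalySteadySourceFormal.Census3

end
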